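import Literature.AlgebraicGeometry.Resolution.AlterationsStableModel
import Literature.AlgebraicGeometry.Resolution.ChowLemmaProofs
import Literature.AlgebraicGeometry.Resolution.FiniteBirationalNormal
import Mathlib.AlgebraicGeometry.ZariskisMainTheorem
import HarnessLib

/-!
# De Jong's alteration theorem, 4.18–4.21: the closure `T` of the graph of `β`, the three-point
# lemma and Serre's criterion as named facts — 4.21 PROVED from them

Topic: `Literature/AlgebraicGeometry/Resolution`. Companion to `AlterationsThreePointExtension.lean`,
which vendors de Jong 1996, 4.18–4.21 with the opening of 4.22 as ONE named fact
`DeJong1996ThreePointExtension`. The printed 4.18–4.21 run, in "a slightly more general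
situation":

> "4.18. […] Suppose we are given a proper morphism `f : X → S` of integral excellent schemes,
> with sections `σ₁, …, σₙ` satisfying the following properties: a) All fibres of `f` are
> nonempty, geometrically connected and equidimensional of dimension 1. b) The smooth locus of
> `f` is dense in all fibres. c) The generic fibre of `f` is smooth. e) For all geometric points
> `s̄` of `S` and any irreducible component `C` of `X_s̄` we have for `Z = ⋃ σᵢ(S)` that
> `# sm(X/Y) ∩ C ∩ Z ≥ 3`. g) There exist a stable `n`-pointed curve `(𝒞, τ₁, …, τₙ)` over `S`,
> a nonempty open subscheme `U ⊂ S` and an isomorphism `β : 𝒞_U → X_U` mapping the section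
> `τᵢ|_U` to the section `σᵢ|_U`. Let us define `T` as the closure of `Γ_β` in the scheme
> `𝒞 ×_S X`. Note that `T` is integral […] we may assume […] h) Both `X` and `T`, defined as
> above, are flat over `S`. […] i) The scheme `S` is normal.
> 4.19. Assume we have `X`, `S` as above, satisfying a)–c), e) and g)–i). We will show that `β`
> extends to a morphism. […] 4.20. Lemma. […] 4.21. In the situation of 4.19, the lemma
> implies that the morphism `pr₁ : T → 𝒞` has finite fibres, hence is a finite morphism. We
> remark that `𝒞` is a normal scheme: it is flat over a normal excellent scheme, with reduced
> fibres of dimension 1, hence condition S₂ is fullfilled; the smooth locus of `𝒞 → S` is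
> dense in all fibres and the generic fibre is smooth, hence `𝒞` is regular in codimension 1;
> apply the criterium of Serre (S₂ + R₁ ⇒ normal). Thus the birational finite morphism
> `pr₁ : T → 𝒞` is an isomorphism. We conclude that the properties a)–c), e) and g) on data
> `X → S`, `σᵢ` as in 4.18 imply that the rational map `β` extends to a birational morphism
> `β : 𝒞 → X`, at least after replacing `S` by a modification and `𝒞` and `X` by their strict
> transforms." (pp. 72–74)

This file

* constructs **`T`**: the graph morphism `Γ_β : 𝒞_U → 𝒞 ×_S X` of `β`
  (`DeJong1996.graphMorphism`) and the closure of its image, as the scheme-theoretic image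
  (`DeJong1996.graphClosure`, Mathlib's `Scheme.Hom.image`; for the reduced `𝒞_U` and the
  quasi-compact `Γ_β` this is the reduced closed subscheme on the closure of `Γ_β(𝒞_U)`), with
  its projections `pr₁ : T → 𝒞` (`graphClosureFst`), `pr₂ : T → X` (`graphClosureSnd`),
  `T → S` (`graphClosureMap`) and `𝒞_U → T` (`toGraphClosure`); PROVED: "Note that `T` is
  integral" (`isIntegral_graphClosure`), "`pr₁` […] birational" (`isBirational_graphClosureFst`:
  `𝒞_U → T` is a dominant section of the separated `pr₁` over `𝒞_U`, so `pr₁` is an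
  isomorphism over `𝒞_U`), and **the extension of `β` once `pr₁` is an isomorphism**
  (`graphClosureExtension = pr₁⁻¹ ≫ pr₂ : 𝒞 → X`: an `S`-morphism restricting to `β` on `𝒞_U`,
  an isomorphism over `U`, and carrying `τᵢ` to `σᵢ` — two sections of the separated `f` over
  the reduced `S` which agree on the dense `U`);
* renders **Situation 4.18 a)–c), e), g)** as the structure `DeJong1996.ThreePointSituation`
  (a)–c) = `DeJong1996.IsCurveFibration`, e) = `DeJong1996.HasThreeSmoothPoints` for
  `Z = ⋃ σᵢ(S)`, g) with "stable `n`-pointed" rendered as in `AlterationsStableModel.lean` by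
  `DeJong1996.IsPointedSemiStableCurve` — of stability only nodality, disjointness of the
  labelled points and their lying in the smooth locus are used in 4.20 — and `𝒞` integral);
  "excellent" is not available in Mathlib and enters the named facts as `IsNoetherian S`, which
  is all 4.19–4.21 use of it;
* vendors as NAMED FACTS **Lemma 4.20 in the form 4.21 draws from it**
  (`DeJong1996GraphClosureFiniteFibres`: under a)–c), e), g), h), i), `pr₁ : T → 𝒞` has finite
  fibres) and **the normality remark of 4.21** (`DeJong1996SemiStableCurveNormal`: a semi-stable
  curve over an integral normal Noetherian base with smooth generic fibre is a normal scheme —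
  Serre's criterion);
* PROVES **4.21** from these (`DeJong1996.ThreePointSituation.isIso_graphClosureFst`: finite
  fibres and proper give finite, by Zariski's Main Theorem in Mathlib's form
  `IsFinite.of_isProper_of_locallyQuasiFinite`; finite birational onto the normal integral `𝒞`
  gives an isomorphism, `isIso_of_isFinite_of_isBirational`) and the conclusion "`β` extends to
  a birational morphism `β : 𝒞 → X`" with its properties
  (`DeJong1996.ThreePointSituation.exists_extension`).

The reduction of 4.18 (flattening 2.19 of `X` and `T` by a modification, normalisation of the
base, transport of a)–c), e), g) to strict transforms) and the glue to
`DeJong1996ThreePointExtension` are in the companion `AlterationsThreePointFlattening.lean`.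

## Sources

* A. J. de Jong, *Smoothness, semi-stability and alterations*, Publ. Math. IHÉS 83 (1996) 51–93:
  2.7, 2.17–2.21 (pp. 59–61), 4.15–4.17 (pp. 71–72), 4.18–4.22 (pp. 72–74).
* The Stacks Project, Tag 01R8 (scheme-theoretic image), Tag 02LS (proper + quasi-finite is
  finite), Tag 031S / 0345 (Serre's criterion).
-/

noncomputable section

open CategoryTheory CategoryTheory.Limits AlgebraicGeometry TopologicalSpace Topology

namespace Literature.AlgebraicGeometry.Resolution

universe u

namespace DeJong1996

/-! ## The closure `T` of the graph of `β` -/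

section Graph

variable {X S C : Scheme.{u}} (f : X ⟶ S) (p : C ⟶ S) (U : S.Opens)
  (β : ((p ⁻¹ᵁ U : C.Opens) : Scheme.{u}) ⟶ (f ⁻¹ᵁ U : X.Opens))
  (hβ : β ≫ (f ⁻¹ᵁ U).ι ≫ f = (p ⁻¹ᵁ U).ι ≫ p)

/-- **The graph `Γ_β : 𝒞_U → 𝒞 ×_S X` of `β : 𝒞_U → X_U`** (de Jong 1996, 4.18: "the closure of
`Γ_β` in the scheme `𝒞 ×_S X`"): the `S`-morphism `(ι, β ≫ ι)`. [cite: DeJong1996, 4.18, p. 72] -/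
def graphMorphism : ((p ⁻¹ᵁ U : C.Opens) : Scheme.{u}) ⟶ pullback p f :=
  pullback.lift (p ⁻¹ᵁ U).ι (β ≫ (f ⁻¹ᵁ U).ι) (by rw [Category.assoc]; exact hβ.symm)

/-- `Γ_β ≫ pr₁` is the inclusion `𝒞_U ↪ 𝒞`. [folklore] -/
@[reassoc (attr := simp)]
theorem graphMorphism_fst : graphMorphism f p U β hβ ≫ pullback.fst p f = (p ⁻¹ᵁ U).ι :=
  pullback.lift_fst _ _ _

/-- `Γ_β ≫ pr₂` is `β` followed by `X_U ↪ X`. [folklore] -/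
@[reassoc (attr := simp)]
theorem graphMorphism_snd : graphMorphism f p U β hβ ≫ pullback.snd p f = β ≫ (f ⁻¹ᵁ U).ι :=
  pullback.lift_snd _ _ _

/-- **`T`, the closure of `Γ_β` in `𝒞 ×_S X`** (de Jong 1996, 4.18), as the scheme-theoretic
image of the graph morphism. [cite: DeJong1996, 4.18, p. 72] -/
def graphClosure : Scheme.{u} :=
  (graphMorphism f p U β hβ).image

/-- The closed immersion `T ↪ 𝒞 ×_S X`. [cite: DeJong1996, 4.18, p. 72] -/
def graphClosureι : graphClosure f p U β hβ ⟶ pullback p f :=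
  (graphMorphism f p U β hβ).imageι

/-- `pr₁ : T → 𝒞` (de Jong 1996, 4.19). [cite: DeJong1996, 4.19, p. 73] -/
def graphClosureFst : graphClosure f p U β hβ ⟶ C :=
  graphClosureι f p U β hβ ≫ pullback.fst p f

/-- `pr₂ : T → X` (de Jong 1996, 4.19). [cite: DeJong1996, 4.19, p. 73] -/
def graphClosureSnd : graphClosure f p U β hβ ⟶ X :=
  graphClosureι f p U β hβ ≫ pullback.snd p f

/-- The structure morphism `T → S` (4.18 h): "Both `X` and `T` […] are flat over `S`").
[cite: DeJong1996, 4.18, p. 72] -/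
def graphClosureMap : graphClosure f p U β hβ ⟶ S :=
  graphClosureFst f p U β hβ ≫ p

/-- `𝒞_U → T`, the corestriction of `Γ_β` ("the closure of the integral scheme `Γ_β ≅ 𝒞_U`").
[cite: DeJong1996, 4.18, p. 72] -/
def toGraphClosure : ((p ⁻¹ᵁ U : C.Opens) : Scheme.{u}) ⟶ graphClosure f p U β hβ :=
  (graphMorphism f p U β hβ).toImage

/-- `T ↪ 𝒞 ×_S X` is a closed immersion. [folklore] -/
instance isClosedImmersion_graphClosureι : IsClosedImmersion (graphClosureι f p U β hβ) :=
  inferInstanceAs (IsClosedImmersion (graphMorphism f p U β hβ).ker.subschemeι)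

/-- `𝒞_U → T ↪ 𝒞 ×_S X` is `Γ_β`. [folklore] -/
@[reassoc (attr := simp)]
theorem toGraphClosure_ι : toGraphClosure f p U β hβ ≫ graphClosureι f p U β hβ =
    graphMorphism f p U β hβ :=
  Scheme.Hom.toImage_imageι _

/-- `𝒞_U → T → 𝒞` is the inclusion. [folklore] -/
@[reassoc (attr := simp)]
theorem toGraphClosure_fst : toGraphClosure f p U β hβ ≫ graphClosureFst f p U β hβ = (p ⁻¹ᵁ U).ι := by
  rw [graphClosureFst, toGraphClosure_ι_assoc, graphMorphism_fst]

/-- `𝒞_U → T → X` is `β` followed by the inclusion. [folklore] -/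
@[reassoc (attr := simp)]
theorem toGraphClosure_snd :
    toGraphClosure f p U β hβ ≫ graphClosureSnd f p U β hβ = β ≫ (f ⁻¹ᵁ U).ι := by
  rw [graphClosureSnd, toGraphClosure_ι_assoc, graphMorphism_snd]

/-- `pr₂ ≫ f = pr₁ ≫ p`: `T` lives over `S`. [folklore] -/
@[reassoc]
theorem graphClosureSnd_comp : graphClosureSnd f p U β hβ ≫ f = graphClosureFst f p U β hβ ≫ p := by
  simp only [graphClosureSnd, graphClosureFst, Category.assoc, pullback.condition]

/-- `T → S` factors through `pr₂` and `f` as well. [folklore] -/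
theorem graphClosureMap_eq : graphClosureMap f p U β hβ = graphClosureSnd f p U β hβ ≫ f := by
  rw [graphClosureMap, graphClosureSnd_comp]

/-- `pr₁ : T → 𝒞` is separated when `f` is. [folklore] -/
instance isSeparated_graphClosureFst [IsSeparated f] : IsSeparated (graphClosureFst f p U β hβ) := by
  delta graphClosureFst; infer_instance

/-- `pr₁ : T → 𝒞` is proper when `f` is ("The proper morphism `pr₂`" — and symmetrically
`pr₁`, 4.20). [folklore] -/
instance isProper_graphClosureFst [IsProper f] : IsProper (graphClosureFst f p U β hβ) := by
  delta graphClosureFst; infer_instance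

/-- `pr₁ : T → 𝒞` is locally of finite type when `f` is. [folklore] -/
instance locallyOfFiniteType_graphClosureFst [LocallyOfFiniteType f] :
    LocallyOfFiniteType (graphClosureFst f p U β hβ) := by
  delta graphClosureFst; infer_instance

/-- `pr₂ : T → X` is proper when `p` is. [folklore] -/
instance isProper_graphClosureSnd [IsProper p] : IsProper (graphClosureSnd f p U β hβ) := by
  delta graphClosureSnd; infer_instance

/-- `pr₂ : T → X` is separated when `p` is. [folklore] -/
instance isSeparated_graphClosureSnd [IsSeparated p] : IsSeparated (graphClosureSnd f p U β hβ) := by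
  delta graphClosureSnd; infer_instance

/-- `T → S` is proper when `f` and `p` are. [folklore] -/
instance isProper_graphClosureMap [IsProper f] [IsProper p] : IsProper (graphClosureMap f p U β hβ) := by
  delta graphClosureMap; infer_instance

/-- `Γ_β` is quasi-compact as soon as `𝒞_U ↪ 𝒞` is (e.g. `𝒞` Noetherian) and `f` is
quasi-separated: `Γ_β ≫ pr₁ = (𝒞_U ↪ 𝒞)`. [folklore] -/
instance quasiCompact_graphMorphism [QuasiCompact (p ⁻¹ᵁ U).ι] [QuasiSeparated f] :
    QuasiCompact (graphMorphism f p U β hβ) := by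
  have : QuasiCompact (graphMorphism f p U β hβ ≫ pullback.fst p f) := by
    rw [graphMorphism_fst]; infer_instance
  exact .of_comp _ (pullback.fst p f)

/-- `𝒞_U → T` is dominant (for `Γ_β` quasi-compact). [folklore] -/
instance isDominant_toGraphClosure [QuasiCompact (graphMorphism f p U β hβ)] :
    IsDominant (toGraphClosure f p U β hβ) :=
  inferInstanceAs (IsDominant (graphMorphism f p U β hβ).toImage)

/-- **The underlying set of `T` is the closure of the graph** `Γ_β(𝒞_U)` (Stacks 01R8, for
`Γ_β` quasi-compact). [folklore] -/
theorem range_graphClosureι [QuasiCompact (graphMorphism f p U β hβ)] :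
    Set.range (graphClosureι f p U β hβ) = closure (Set.range (graphMorphism f p U β hβ)) := by
  have h := Scheme.IdealSheafData.range_subschemeι (graphMorphism f p U β hβ).ker
  rw [Scheme.Hom.support_ker] at h
  exact h

/-- `T` is reduced when `𝒞_U` is (and `Γ_β` is quasi-compact). [folklore] -/
theorem isReduced_graphClosure [QuasiCompact (graphMorphism f p U β hβ)]
    [IsReduced ((p ⁻¹ᵁ U : C.Opens) : Scheme.{u})] : IsReduced (graphClosure f p U β hβ) :=
  ChowLemmaProof.isReduced_image _

/-- **"Note that `T` is integral, as it is the closure of the integral scheme `Γ_β ≅ 𝒞_U`"**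
(de Jong 1996, 4.18), for `𝒞_U` integral and `Γ_β` quasi-compact. [cite: DeJong1996, 4.18, p. 72] -/
theorem isIntegral_graphClosure [QuasiCompact (graphMorphism f p U β hβ)]
    [IsIntegral ((p ⁻¹ᵁ U : C.Opens) : Scheme.{u})] : IsIntegral (graphClosure f p U β hβ) :=
  ChowLemmaProof.isIntegral_image _

/-- **`pr₁ : T → 𝒞` is an isomorphism over `𝒞_U` and `pr₁⁻¹(𝒞_U)` is dense in `T`**: `𝒞_U → T`
is a dominant section of the separated `pr₁` over the open `𝒞_U`, and `T` is reduced
(`ChowLemmaProof.isIso_morphismRestrict_of_section`). [folklore] -/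
theorem isIso_graphClosureFst_morphismRestrict [IsSeparated f]
    [QuasiCompact (graphMorphism f p U β hβ)] [IsReduced ((p ⁻¹ᵁ U : C.Opens) : Scheme.{u})] :
    IsIso (graphClosureFst f p U β hβ ∣_ (p ⁻¹ᵁ U)) ∧
      Dense ((graphClosureFst f p U β hβ ⁻¹ᵁ (p ⁻¹ᵁ U) : (graphClosure f p U β hβ).Opens) :
        Set (graphClosure f p U β hβ)) :=
  haveI := isReduced_graphClosure f p U β hβ
  ChowLemmaProof.isIso_morphismRestrict_of_section (graphClosureFst f p U β hβ) (p ⁻¹ᵁ U)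
    (toGraphClosure f p U β hβ) (toGraphClosure_fst f p U β hβ)

/-- **"`pr₁ : T → 𝒞` […] birational"** (de Jong 1996, 4.19: "We remark that these are
birational, i.e. modifications"), for `𝒞` irreducible with `𝒞_U` non-empty and reduced.
[cite: DeJong1996, 4.19, p. 73] -/
theorem isBirational_graphClosureFst [IsSeparated f] [IrreducibleSpace C]
    [QuasiCompact (graphMorphism f p U β hβ)] [IsReduced ((p ⁻¹ᵁ U : C.Opens) : Scheme.{u})]
    (hne : ((p ⁻¹ᵁ U : C.Opens) : Set C).Nonempty) : IsBirational (graphClosureFst f p U β hβ) := by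
  obtain ⟨hiso, hdense⟩ := isIso_graphClosureFst_morphismRestrict f p U β hβ
  exact ⟨p ⁻¹ᵁ U, (p ⁻¹ᵁ U).isOpen.dense hne, hdense, hiso⟩

/-! ### Extending `β` once `pr₁ : T → 𝒞` is an isomorphism -/

/-- **The extension of `β`** when `pr₁ : T → 𝒞` is an isomorphism (4.21: "Thus the birational
finite morphism `pr₁ : T → 𝒞` is an isomorphism. We conclude that […] `β` extends to a
birational morphism `β : 𝒞 → X`"): `β̄ = pr₁⁻¹ ≫ pr₂`. [cite: DeJong1996, 4.21, p. 74] -/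
def graphClosureExtension (hiso : IsIso (graphClosureFst f p U β hβ)) : C ⟶ X :=
  haveI := hiso
  inv (graphClosureFst f p U β hβ) ≫ graphClosureSnd f p U β hβ

/-- `β̄` is an `S`-morphism: `β̄ ≫ f = p`. [folklore] -/
@[reassoc (attr := simp)]
theorem graphClosureExtension_comp (hiso : IsIso (graphClosureFst f p U β hβ)) :
    graphClosureExtension f p U β hβ hiso ≫ f = p := by
  haveI := hiso
  rw [graphClosureExtension, Category.assoc, graphClosureSnd_comp, IsIso.inv_hom_id_assoc]

/-- **`β̄` extends `β`**: on `𝒞_U` it is `β` followed by `X_U ↪ X`. [cite: DeJong1996, 4.21, p. 74] -/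
@[reassoc]
theorem ι_graphClosureExtension (hiso : IsIso (graphClosureFst f p U β hβ)) :
    (p ⁻¹ᵁ U).ι ≫ graphClosureExtension f p U β hβ hiso = β ≫ (f ⁻¹ᵁ U).ι := by
  haveI := hiso
  rw [← toGraphClosure_fst f p U β hβ, graphClosureExtension, Category.assoc,
    IsIso.hom_inv_id_assoc, toGraphClosure_snd]

/-- `β̄⁻¹(X_U) = 𝒞_U`. [folklore] -/
theorem graphClosureExtension_preimage (hiso : IsIso (graphClosureFst f p U β hβ)) :
    graphClosureExtension f p U β hβ hiso ⁻¹ᵁ (f ⁻¹ᵁ U) = p ⁻¹ᵁ U := by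
  rw [← Scheme.Hom.comp_preimage, graphClosureExtension_comp]

/-- Over `U`, `β̄` is `β` up to the identification `β̄⁻¹(X_U) = 𝒞_U`. [folklore] -/
theorem isoOfEq_hom_graphClosureExtension_morphismRestrict
    (hiso : IsIso (graphClosureFst f p U β hβ)) :
    (C.isoOfEq (graphClosureExtension_preimage f p U β hβ hiso).symm).hom ≫
        (graphClosureExtension f p U β hβ hiso ∣_ f ⁻¹ᵁ U) = β := by
  rw [← cancel_mono (f ⁻¹ᵁ U).ι, Category.assoc, morphismRestrict_ι, Scheme.isoOfEq_hom_ι_assoc,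
    ι_graphClosureExtension]

/-- **`β̄` is an isomorphism over `U`** (it is `β` there). [cite: DeJong1996, 4.21–4.22, p. 74] -/
theorem isIso_graphClosureExtension_morphismRestrict [IsIso β]
    (hiso : IsIso (graphClosureFst f p U β hβ)) :
    IsIso (graphClosureExtension f p U β hβ hiso ∣_ f ⁻¹ᵁ U) := by
  have h := isoOfEq_hom_graphClosureExtension_morphismRestrict f p U β hβ hiso
  rw [← Iso.eq_inv_comp] at h
  rw [h]
  infer_instance

/-- **`β̄` maps the section `τ` to the section `σ`** as soon as `β` does so over `U`: two
sections (`τ ≫ β̄` and `σ`) of the separated `f` over the reduced `S` which agree on the dense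
open `U` agree (Mathlib's `ext_of_isDominant_of_isSeparated`). [cite: DeJong1996, 4.22, p. 74] -/
theorem comp_graphClosureExtension_eq [IsSeparated f] [IsReduced S] [IrreducibleSpace S]
    (hU : (U : Set S).Nonempty) (hiso : IsIso (graphClosureFst f p U β hβ)) {τ : S ⟶ C}
    {σ : S ⟶ X} (hτ : τ ≫ p = 𝟙 S) (hσ : σ ≫ f = 𝟙 S)
    (t : (U : Scheme.{u}) ⟶ (p ⁻¹ᵁ U : C.Opens)) (ht : t ≫ (p ⁻¹ᵁ U).ι = U.ι ≫ τ)
    (htβ : t ≫ β ≫ (f ⁻¹ᵁ U).ι = U.ι ≫ σ) :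
    τ ≫ graphClosureExtension f p U β hβ hiso = σ := by
  haveI : IsDominant U.ι := AlgebraicGeometry.Opens.isDominant_ι (U.isOpen.dense hU)
  refine ext_of_isDominant_of_isSeparated f ?_ U.ι ?_
  · rw [Category.assoc, graphClosureExtension_comp, hτ, hσ]
  · rw [← Category.assoc U.ι τ, ← ht, Category.assoc, ι_graphClosureExtension, htβ]

end Graph

/-! ## Situation 4.18 -/

/-- **de Jong 1996, Situation 4.18 a)–c), e), g).** "Suppose we are given a proper morphism
`f : X → S` of integral excellent schemes, with sections `σ₁, …, σₙ` satisfying the following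
properties: a) All fibres of `f` are nonempty, geometrically connected and equidimensional of
dimension 1. b) The smooth locus of `f` is dense in all fibres. c) The generic fibre of `f` is
smooth. e) For all geometric points `s̄` of `S` and any irreducible component `C` of `X_s̄` we
have for `Z = ⋃ σᵢ(S)` that `# sm(X/Y) ∩ C ∩ Z ≥ 3`. g) There exist a stable `n`-pointed curve
`(𝒞, τ₁, …, τₙ)` over `S`, a nonempty open subscheme `U ⊂ S` and an isomorphism `β : 𝒞_U → X_U`
mapping the section `τᵢ|_U` to the section `σᵢ|_U`." Rendered with the model `(𝒞, p, τ, U, β)`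
as data: `X` integral, `S` integral (an instance argument; "excellent" is not available and is
replaced in the named facts below by `IsNoetherian S`, which is what 4.19–4.21 use), `f` proper
with sections `σᵢ` (`σᵢ ≫ f = 𝟙`); a)–c) as `IsCurveFibration f` (the rendering of 4.12
(vi) a)–c)); e) as `HasThreeSmoothPoints f (⋃ᵢ σᵢ(S))` (the rendering of 4.14 (vi) e)); g) as
in `HasPointedSemiStableModel`: `(p : 𝒞 → S, τ)` a pointed semi-stable curve
(`IsPointedSemiStableCurve` — of "stable `n`-pointed" the proof of Lemma 4.20 uses only that the
geometric fibres are nodal, that the labelled points are pairwise distinct and that they are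
smooth points of the fibres), `𝒞` integral (automatic: `𝒞 → S` is flat with `𝒞_U ≅ X_U`
integral; recorded for convenience, cf. "the integral scheme `Γ_β ≅ 𝒞_U`"), `U ⊆ S` a non-empty
open, `β : p⁻¹(U) ⥲ f⁻¹(U)` an isomorphism over `S` (`β ≫ ι ≫ f = ι ≫ p`), and for each `i` the
corestriction `t` of `τᵢ|_U` to `p⁻¹(U)` satisfies `β ∘ t = σᵢ|_U`.
[cite: DeJong1996, 4.18, p. 72] -/
structure ThreePointSituation {X S C : Scheme.{u}} [IsIntegral S] (f : X ⟶ S)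
    [LocallyOfFinitePresentation f] {n : ℕ} (σ : Fin n → (S ⟶ X)) (p : C ⟶ S)
    (τ : Fin n → (S ⟶ C)) (U : S.Opens)
    (β : ((p ⁻¹ᵁ U : C.Opens) : Scheme.{u}) ⟶ (f ⁻¹ᵁ U : X.Opens)) : Prop where
  /-- `X` is integral -/
  isIntegral : IsIntegral X
  /-- `f` is proper -/
  isProper : IsProper f
  /-- the `σᵢ` are sections of `f` -/
  comp_eq_id : ∀ i, σ i ≫ f = 𝟙 S
  /-- a), b), c): `f` is a curve fibration in the sense of 4.12 (vi) a)–c) -/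
  isCurveFibration : IsCurveFibration f
  /-- e): every irreducible component of every geometric fibre carries three smooth points of
  `Z = ⋃ᵢ σᵢ(S)` -/
  hasThreeSmoothPoints : HasThreeSmoothPoints f (⋃ i, Set.range (σ i))
  /-- g): `𝒞` is integral -/
  isIntegral_model : IsIntegral C
  /-- g): `(p : 𝒞 → S, τ)` is a pointed semi-stable curve -/
  isPointedSemiStableCurve : IsPointedSemiStableCurve p τ
  /-- g): `U` is non-empty -/
  nonempty : (U : Set S).Nonempty
  /-- g): `β` is an isomorphism -/
  isIso : IsIso β
  /-- g): `β` is a morphism over `S` -/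
  comm : β ≫ (f ⁻¹ᵁ U).ι ≫ f = (p ⁻¹ᵁ U).ι ≫ p
  /-- g): `β` maps `τᵢ|_U` to `σᵢ|_U` -/
  fac : ∀ i, ∃ t : (U : Scheme.{u}) ⟶ (p ⁻¹ᵁ U : C.Opens),
    t ≫ (p ⁻¹ᵁ U).ι = U.ι ≫ τ i ∧ t ≫ β ≫ (f ⁻¹ᵁ U).ι = U.ι ≫ σ i

namespace ThreePointSituation

variable {X S C : Scheme.{u}} [IsIntegral S] {f : X ⟶ S} [LocallyOfFinitePresentation f] {n : ℕ}
  {σ : Fin n → (S ⟶ X)} {p : C ⟶ S} {τ : Fin n → (S ⟶ C)} {U : S.Opens}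
  {β : ((p ⁻¹ᵁ U : C.Opens) : Scheme.{u}) ⟶ (f ⁻¹ᵁ U : X.Opens)}

/-- `f` is separated. [folklore] -/
theorem isSeparated (h : ThreePointSituation f σ p τ U β) : IsSeparated f :=
  haveI := h.isProper
  inferInstance

/-- `p : 𝒞 → S` is proper. [folklore] -/
theorem isProper_model (h : ThreePointSituation f σ p τ U β) : IsProper p :=
  h.isPointedSemiStableCurve.isSemiStableCurve.isProper

/-- `p : 𝒞 → S` is flat. [folklore] -/
theorem flat_model (h : ThreePointSituation f σ p τ U β) : Flat p :=
  h.isPointedSemiStableCurve.isSemiStableCurve.flat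

/-- `S` is Noetherian as soon as it is locally Noetherian: it is quasi-compact, being the image
of the quasi-compact `X` — not needed; we record instead that `𝒞` is Noetherian over a
Noetherian `S` (`p` is of finite type). [folklore] -/
theorem isNoetherian_model [IsNoetherian S] (h : ThreePointSituation f σ p τ U β) :
    IsNoetherian C := by
  haveI := h.isProper_model
  haveI : IsLocallyNoetherian C := LocallyOfFiniteType.isLocallyNoetherian (f := p)
  haveI : CompactSpace C := by
    haveI : QuasiCompact p := inferInstance
    haveI : CompactSpace S := inferInstance
    exact QuasiCompact.compactSpace_of_compactSpace p
  exact {}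

/-- `Γ_β` is quasi-compact over a Noetherian base. [folklore] -/
theorem quasiCompact_graphMorphism [IsNoetherian S] (h : ThreePointSituation f σ p τ U β) :
    QuasiCompact (graphMorphism f p U β h.comm) := by
  haveI := h.isNoetherian_model
  haveI := h.isSeparated
  haveI : NoetherianSpace ((p ⁻¹ᵁ U : C.Opens) : Scheme.{u}) :=
    (noetherianSpace_set_iff _).mpr fun s _ => NoetherianSpace.isCompact s
  infer_instance

/-- `𝒞_U` is non-empty: it is isomorphic to `X_U = f⁻¹(U)`, and `f` is surjective with `U ≠ ∅`.
[folklore] -/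
theorem nonempty_preimage (h : ThreePointSituation f σ p τ U β) :
    ((p ⁻¹ᵁ U : C.Opens) : Set C).Nonempty := by
  obtain ⟨s, hs⟩ := h.nonempty
  haveI := h.isCurveFibration.surjective
  obtain ⟨x, hx⟩ := f.surjective s
  haveI := h.isIso
  let c : ((p ⁻¹ᵁ U : C.Opens) : Scheme.{u}) := inv β ⟨x, show f x ∈ U by rw [hx]; exact hs⟩
  refine ⟨(p ⁻¹ᵁ U).ι c, ?_⟩
  have : (p ⁻¹ᵁ U).ι c ∈ Set.range (p ⁻¹ᵁ U).ι := ⟨c, rfl⟩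
  rwa [Scheme.Opens.range_ι] at this

/-- `𝒞_U` is integral (a non-empty open subscheme of the integral `𝒞`). [folklore] -/
theorem isIntegral_preimage (h : ThreePointSituation f σ p τ U β) :
    IsIntegral ((p ⁻¹ᵁ U : C.Opens) : Scheme.{u}) := by
  haveI := h.isIntegral_model
  haveI : Nonempty ((p ⁻¹ᵁ U : C.Opens) : Scheme.{u}) := by
    obtain ⟨c, hc⟩ := h.nonempty_preimage
    exact ⟨⟨c, hc⟩⟩
  exact isIntegral_of_isOpenImmersion (p ⁻¹ᵁ U).ι

/-- **"Note that `T` is integral"** (4.18). [cite: DeJong1996, 4.18, p. 72] -/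
theorem isIntegral_graphClosure [IsNoetherian S] (h : ThreePointSituation f σ p τ U β) :
    IsIntegral (graphClosure f p U β h.comm) :=
  haveI := h.quasiCompact_graphMorphism
  haveI := h.isIntegral_preimage
  DeJong1996.isIntegral_graphClosure f p U β h.comm

/-- **"`pr₁ : T → 𝒞` […] birational"** (4.19). [cite: DeJong1996, 4.19, p. 73] -/
theorem isBirational_graphClosureFst [IsNoetherian S] (h : ThreePointSituation f σ p τ U β) :
    IsBirational (graphClosureFst f p U β h.comm) :=
  haveI := h.quasiCompact_graphMorphism
  haveI := h.isIntegral_preimage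
  haveI := h.isIntegral_model
  haveI := h.isSeparated
  DeJong1996.isBirational_graphClosureFst f p U β h.comm h.nonempty_preimage

end ThreePointSituation

end DeJong1996

/-! ## Lemma 4.20 (as used in 4.21) and the normality remark of 4.21, as named facts -/

/-- NAMED FACT — **de Jong 1996, Lemma 4.20 in the form 4.21 draws from it: "In the situation of
4.19, the lemma implies that the morphism `pr₁ : T → 𝒞` has finite fibres".** In Situation 4.18
a)–c), e), g) (`DeJong1996.ThreePointSituation f σ p τ U β`) over an integral Noetherian base `S`
("excellent" in the text) assume moreover "h) Both `X` and `T`, defined as above [the closure of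
`Γ_β` in `𝒞 ×_S X`, `DeJong1996.graphClosure`], are flat over `S`" and "i) The scheme `S` is
normal" (all local rings integrally closed). Then every fibre of `pr₁ : T → 𝒞`
(`DeJong1996.graphClosureFst`) is a finite set. The printed route: for `s ∈ S` decompose
`X_s`, `𝒞_s`, `T_s` (pure of dimension 1 as `T → S` is flat) into irreducible components;
Lemma 4.20: "(i) For each `i` there is exactly one `j = jᵢ` such that `pr₂(Tᵢ) = X_j`. There is
an open subscheme `V ⊂ X` such that `V ∩ Xᵢ` is nonempty, and `pr₂⁻¹(V) → V` is an isomorphism.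
The morphism `pr₁ : Tᵢ → 𝒞_s` is nonconstant. (ii) [the same for `pr₁` and the `Cᵢ`]" — by 2.7,
normality of `X` at smooth points over the normal `S`, finite birational onto normal is an
isomorphism, Stein factorisation (`pr₂⁻¹(x)` is connected for `x ∈ sm(X/S)`), and the two cases
"three distinct components through the point `c ∈ 𝒞_s̄`. This contradicts the semi-stability"
and "the curves `pr₁(T_β)` and `pr₁(T_γ)` meet in the labeled point `c = c_α`", a smooth point of
the fibre; an infinite fibre of `pr₁` over a point of `𝒞_s` would contain a component `Tᵢ` of
`T_s` on which `pr₁` is constant. Users take `(h : DeJong1996GraphClosureFiniteFibres)`.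
[cite: DeJong1996, Lemma 4.20 and 4.21, pp. 73–74] -/
def DeJong1996GraphClosureFiniteFibres : Prop :=
  ∀ (X S C : Scheme.{u}) [IsIntegral S] [IsNoetherian S] (f : X ⟶ S)
    [LocallyOfFinitePresentation f] (n : ℕ) (σ : Fin n → (S ⟶ X)) (p : C ⟶ S)
    (τ : Fin n → (S ⟶ C)) (U : S.Opens)
    (β : ((p ⁻¹ᵁ U : C.Opens) : Scheme.{u}) ⟶ (f ⁻¹ᵁ U : X.Opens))
    (h : DeJong1996.ThreePointSituation f σ p τ U β),
    (∀ s : S, IsIntegrallyClosed (S.presheaf.stalk s)) → Flat f →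
      Flat (DeJong1996.graphClosureMap f p U β h.comm) →
        ∀ c : C, (DeJong1996.graphClosureFst f p U β h.comm ⁻¹' {c}).Finite

/-- NAMED FACT — **de Jong 1996, 4.21: "We remark that `𝒞` is a normal scheme: it is flat over a
normal excellent scheme, with reduced fibres of dimension 1, hence condition S₂ is fullfilled;
the smooth locus of `𝒞 → S` is dense in all fibres and the generic fibre is smooth, hence `𝒞` is
regular in codimension 1; apply the criterium of Serre (S₂ + R₁ ⇒ normal)."** Rendered: for a
semi-stable curve `p : 𝒞 → S` (`IsSemiStableCurve`, 2.21: flat, proper, of finite presentation,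
geometric fibres connected nodal curves — so the fibres are reduced of dimension `1` and the
smooth locus is dense in them) over an integral Noetherian scheme `S` all of whose local rings
are integrally closed, with smooth generic fibre, every local ring of `𝒞` is integrally closed.
Users take `(h : DeJong1996SemiStableCurveNormal)`. [cite: DeJong1996, 4.21, p. 74] -/
def DeJong1996SemiStableCurveNormal : Prop :=
  ∀ (C S : Scheme.{u}) [IsIntegral S] [IsNoetherian S] (p : C ⟶ S), IsSemiStableCurve p →
    (∀ s : S, IsIntegrallyClosed (S.presheaf.stalk s)) →
      Smooth (p.fiberToSpecResidueField (genericPoint S)) →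
        ∀ c : C, IsIntegrallyClosed (C.presheaf.stalk c)

/-! ## 4.21, proved from the two facts -/

namespace DeJong1996.ThreePointSituation

variable {X S C : Scheme.{u}} [IsIntegral S] {f : X ⟶ S} [LocallyOfFinitePresentation f] {n : ℕ}
  {σ : Fin n → (S ⟶ X)} {p : C ⟶ S} {τ : Fin n → (S ⟶ C)} {U : S.Opens}
  {β : ((p ⁻¹ᵁ U : C.Opens) : Scheme.{u}) ⟶ (f ⁻¹ᵁ U : X.Opens)}

/-- **The generic fibre of `𝒞 → S` is smooth** in Situation 4.18: over `U ∋ η` the family `𝒞`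
is isomorphic to `X`, whose generic fibre is smooth by c). [cite: DeJong1996, 4.21, p. 74] -/
theorem smooth_fiberToSpecResidueField_genericPoint (h : ThreePointSituation f σ p τ U β) :
    Smooth (p.fiberToSpecResidueField (genericPoint S)) := by
  haveI := h.isIso
  have hη : genericPoint S ∈ U := by
    obtain ⟨s, hs⟩ := h.nonempty
    exact (genericPoint_spec S).mem_open_set_iff U.isOpen |>.mpr ⟨s, Set.mem_univ _, hs⟩
  -- the generic fibres of `p` and `f` are base changes of `p ∣_ U` and `f ∣_ U = β⁻¹ ≫ p ∣_ U`
  -- along `l : Spec κ(η) → U`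
  let iη : Spec (S.residueField (genericPoint S)) ⟶ S := S.fromSpecResidueField (genericPoint S)
  have hX : Smooth (pullback.snd f iη) :=
    h.isCurveFibration.smooth_fiberToSpecResidueField_genericPoint
  have hrange : Set.range iη ⊆ Set.range U.ι := by
    rw [Scheme.Opens.range_ι, Scheme.range_fromSpecResidueField, Set.singleton_subset_iff]
    exact hη
  let l : Spec (S.residueField (genericPoint S)) ⟶ (U : Scheme.{u}) :=
    IsOpenImmersion.lift U.ι iη hrange
  have hl : l ≫ U.ι = iη := IsOpenImmersion.lift_fac _ _ _
  have hpf : p ∣_ U = β ≫ f ∣_ U := by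
    rw [← cancel_mono U.ι, Category.assoc, morphismRestrict_ι, morphismRestrict_ι]
    exact h.comm.symm
  -- `f⁻¹(U) ×_U Spec κ(η)` is the generic fibre of `f`
  have e₂ : IsPullback (pullback.fst (f ∣_ U) l ≫ (f ⁻¹ᵁ U).ι) (pullback.snd (f ∣_ U) l) f iη := by
    rw [← hl]
    exact (IsPullback.of_hasPullback (f ∣_ U) l).paste_horiz (isPullback_morphismRestrict f U).flip
  -- and, through `β`, it is also `p⁻¹(U) ×_U Spec κ(η)`, the generic fibre of `p`
  have e₃ : IsPullback (pullback.fst (f ∣_ U) l ≫ inv β) (pullback.snd (f ∣_ U) l) (p ∣_ U) l := by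
    rw [hpf]
    exact IsPullback.of_iso (IsPullback.of_hasPullback (f ∣_ U) l) (Iso.refl _) (asIso β).symm
      (Iso.refl _) (Iso.refl _) (by simp) (by simp) (by simp) (by simp)
  have e₁ : IsPullback ((pullback.fst (f ∣_ U) l ≫ inv β) ≫ (p ⁻¹ᵁ U).ι)
      (pullback.snd (f ∣_ U) l) p iη := by
    rw [← hl]
    exact e₃.paste_horiz (isPullback_morphismRestrict p U).flip
  have hf' : Smooth (pullback.snd (f ∣_ U) l) := by
    rw [← e₂.isoPullback_hom_snd]
    infer_instance
  change Smooth (pullback.snd p iη)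
  rw [← e₁.isoPullback_inv_snd]
  infer_instance

/-- **de Jong 1996, 4.21, PROVED from Lemma 4.20 and the normality remark: `pr₁ : T → 𝒞` is an
isomorphism.** "In the situation of 4.19, the lemma implies that the morphism `pr₁ : T → 𝒞` has
finite fibres, hence is a finite morphism [proper with finite fibres: Zariski's Main Theorem,
Mathlib `IsFinite.of_isProper_of_locallyQuasiFinite`]. We remark that `𝒞` is a normal scheme
[`DeJong1996SemiStableCurveNormal`]. Thus the birational finite morphism `pr₁ : T → 𝒞` is an
isomorphism [`isIso_of_isFinite_of_isBirational`, `T` being integral]."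
[cite: DeJong1996, 4.21, p. 74] -/
theorem isIso_graphClosureFst [IsNoetherian S] (H₁ : DeJong1996GraphClosureFiniteFibres.{u})
    (H₂ : DeJong1996SemiStableCurveNormal.{u}) (h : ThreePointSituation f σ p τ U β)
    (hS : ∀ s : S, IsIntegrallyClosed (S.presheaf.stalk s)) (hX : Flat f)
    (hT : Flat (graphClosureMap f p U β h.comm)) : IsIso (graphClosureFst f p U β h.comm) := by
  haveI := h.isProper
  haveI := h.isIntegral_model
  haveI := h.isIntegral_graphClosure
  haveI := h.isNoetherian_model
  -- finite fibres (Lemma 4.20) and proper, hence finite (Zariski's Main Theorem)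
  have hfib := H₁ X S C f n σ p τ U β h hS hX hT
  haveI : LocallyQuasiFinite (graphClosureFst f p U β h.comm) :=
    locallyQuasiFinite_iff_finite_preimage_singleton.mpr hfib
  haveI : IsFinite (graphClosureFst f p U β h.comm) :=
    IsFinite.of_isProper_of_locallyQuasiFinite _
  -- `𝒞` is normal (Serre's criterion) and `pr₁` is birational
  have hC : ∀ c : C, IsIntegrallyClosed (C.presheaf.stalk c) :=
    H₂ C S p h.isPointedSemiStableCurve.isSemiStableCurve hS
      h.smooth_fiberToSpecResidueField_genericPoint
  exact isIso_of_isFinite_of_isBirational _ hC h.isBirational_graphClosureFst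

/-- **de Jong 1996, 4.21, conclusion: "the rational map `β` extends to a birational morphism
`β : 𝒞 → X`"** — in Situation 4.18 with h), i) over a Noetherian base, given Lemma 4.20
(`DeJong1996GraphClosureFiniteFibres`) and the normality of `𝒞` (`DeJong1996SemiStableCurveNormal`):
there is an `S`-morphism `β̄ : 𝒞 → X` (`β̄ ≫ f = p`) which restricts to `β` on `𝒞_U`, is an
isomorphism over `U`, and maps the section `τᵢ` to the section `σᵢ` (as 4.22 then uses: "assume
that `β` extends to `β : 𝒞 → X` and we still have (i)–(iv), (vi) a)–g)").
[cite: DeJong1996, 4.21–4.22, p. 74] -/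
theorem exists_extension [IsNoetherian S] (H₁ : DeJong1996GraphClosureFiniteFibres.{u})
    (H₂ : DeJong1996SemiStableCurveNormal.{u}) (h : ThreePointSituation f σ p τ U β)
    (hS : ∀ s : S, IsIntegrallyClosed (S.presheaf.stalk s)) (hX : Flat f)
    (hT : Flat (graphClosureMap f p U β h.comm)) :
    ∃ β' : C ⟶ X, β' ≫ f = p ∧ (p ⁻¹ᵁ U).ι ≫ β' = β ≫ (f ⁻¹ᵁ U).ι ∧ IsIso (β' ∣_ f ⁻¹ᵁ U) ∧
      ∀ i, τ i ≫ β' = σ i := by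
  have hiso := h.isIso_graphClosureFst H₁ H₂ hS hX hT
  haveI := h.isIso
  haveI := h.isSeparated
  refine ⟨graphClosureExtension f p U β h.comm hiso, graphClosureExtension_comp f p U β h.comm hiso,
    ι_graphClosureExtension f p U β h.comm hiso,
    isIso_graphClosureExtension_morphismRestrict f p U β h.comm hiso, fun i => ?_⟩
  obtain ⟨t, ht, htβ⟩ := h.fac i
  exact comp_graphClosureExtension_eq f p U β h.comm h.nonempty hiso
    (h.isPointedSemiStableCurve.comp_eq_id i) (h.comp_eq_id i) t ht htβ

end DeJong1996.ThreePointSituation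

/-! ## Sanity: the facts specialise known truths -/

/-- Sanity for `DeJong1996GraphClosureFiniteFibres`: it is implied by the (stronger) statement
that `pr₁` is an isomorphism in Situation 4.18 with h), i) — an isomorphism has singleton
fibres. [folklore] -/
theorem DeJong1996GraphClosureFiniteFibres.of_isIso
    (H : ∀ (X S C : Scheme.{u}) [IsIntegral S] [IsNoetherian S] (f : X ⟶ S)
      [LocallyOfFinitePresentation f] (n : ℕ) (σ : Fin n → (S ⟶ X)) (p : C ⟶ S)
      (τ : Fin n → (S ⟶ C)) (U : S.Opens)
      (β : ((p ⁻¹ᵁ U : C.Opens) : Scheme.{u}) ⟶ (f ⁻¹ᵁ U : X.Opens))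
      (h : DeJong1996.ThreePointSituation f σ p τ U β),
      (∀ s : S, IsIntegrallyClosed (S.presheaf.stalk s)) → Flat f →
        Flat (DeJong1996.graphClosureMap f p U β h.comm) →
          IsIso (DeJong1996.graphClosureFst f p U β h.comm)) :
    DeJong1996GraphClosureFiniteFibres.{u} := by
  intro X S C _ _ f _ n σ p τ U β h hS hX hT c
  haveI := H X S C f n σ p τ U β h hS hX hT
  have hinj : Function.Injective (DeJong1996.graphClosureFst f p U β h.comm) :=
    (DeJong1996.graphClosureFst f p U β h.comm).homeomorph.injective
  exact Set.Finite.preimage hinj.injOn (Set.finite_singleton c)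

end Literature.AlgebraicGeometry.Resolution

end
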